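import Summits.Ventures.PercRepro0.ClusterS
import Summits.Ventures.PercRepro0.Invariance
import Summits.Ventures.PercRepro0.Russo
import Summits.Ventures.PercRepro0.SharpGlue

/-!
# Theorem S1: exponential decay below `p̃_c` (seat p4, block P5 in Lean: S1, part 2)

SHARP-p4-v2 §2–§3 on `Defs`.  With `φ_p(S) = p · ∑_{x ∈ S} |{y ∉ S : y ∼ x}| · P_p(0 ↔_S x)` (`phi`), for a finite
`S ∋ 0` contained in `Λ_{L−1}`:

* `step_bound` (the induction step of Theorem S1(i), Claims 2–4): `P_p(0 ↔ ∂Λ_{L(k+1)}) ≤ φ_p(S) · P_p(0 ↔ ∂Λ_{Lk})`: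
  partition by the `S`-cluster `C` of `0` (`P_eq_sum_cEq`), last exit of the open path from `C = A` through a bond
  `{x, y}`, `x ∈ A`, `y ∉ S`, after which it avoids `A` inside `Λ_{L(k+1)}` (`exists_exit`, `notMem_of_exit`), independence
  of `{C = A}`, `{ω_{xy} = 1}` and the avoiding connection (F5, `P_inter_eq_mul_of_disjoint`, the three bond sets being
  pairwise disjoint), the translated box bound `P_p(y ↔ ∂Λ_{L(k+1)}) ≤ P_p(0 ↔ ∂Λ_{Lk})` (F2 + the discrete IVT), and the
  regrouping `∑_{A ∋ x} P(C = A) = P(0 ↔_S x)` (`P_connIn_eq_sum_cEq`);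
* `P_toBoundary_mul_le_pow` = Theorem S1(i): `P_p(0 ↔ ∂Λ_{Lk}) ≤ φ_p(S)^k`; `theta_le_phi_pow_div` = S1(ii);
* `theta_le_one_sub` : `P_p(0 ↔ ∂Λ_n) ≤ 1 − (1 − p)^{2d}` for `n ≥ 1` (all bonds at `0` closed);
* `exp_decay_of_phi_lt_one` = Corollary S1′: if `φ_p(S) < 1` for some finite `S ∋ 0` and `p < 1`, then
  `P_p(0 ↔ ∂Λ_n) ≤ e^{−cn}` for all `n ≥ 1`, for some `c > 0` (`Sharp.exp_decay_of_block_bound`).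
-/

namespace Summit.Ventures.PercRepro0.Sharp

open MeasureTheory ProbabilityTheory unitInterval Set
open Summit.Ventures.PercRepro0.Defs
open scoped ENNReal Classical

variable {d : ℕ}

/-! ### Sub-σ-algebra measurability of finitely-determined events -/

/-- An event determined by a finite bond set `E` is `F_E`-measurable. -/
theorem measurableSet_sigmaOn_of_determinedBy {ι : Type*} {E : Set ι} (hE : E.Finite) {A : Set (Set ι)}
    (hdet : DeterminedBy E A) : MeasurableSet[sigmaOn E] A := by
  letI : MeasurableSpace (Set ι) := sigmaOn E
  have hrepr : A = ⋃ η ∈ hE.toFinset.powerset.filter (fun η : Finset ι => (↑η : Set ι) ∈ A),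
      {ω : Set ι | ω ∩ E = ↑η} := by
    ext ω
    simp only [mem_iUnion, mem_setOf_eq, Finset.mem_filter, exists_prop]
    constructor
    · intro hω
      have hfin : (ω ∩ E).Finite := hE.subset inter_subset_right
      refine ⟨hfin.toFinset, ⟨?_, ?_⟩, ?_⟩
      · rw [Finset.mem_powerset, ← Finset.coe_subset, hfin.coe_toFinset, hE.coe_toFinset]
        exact inter_subset_right
      · rw [hfin.coe_toFinset]; exact (hdet ω (ω ∩ E) fun e he => by simp [he]).1 hω
      · rw [hfin.coe_toFinset]
    · rintro ⟨η, ⟨-, hηA⟩, hωη⟩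
      exact (hdet ω (ω ∩ E) fun e he => by simp [he]).2 (hωη ▸ hηA)
  rw [hrepr]
  refine Finset.measurableSet_biUnion _ fun η hη => ?_
  have hηE : ∀ e ∈ η, e ∈ E := fun e he => by
    have := Finset.mem_powerset.1 (Finset.mem_filter.1 hη).1 he
    simpa using this
  have : {ω : Set ι | ω ∩ E = ↑η} = ⋂ e ∈ E, {ω : Set ι | e ∈ ω ↔ e ∈ η} := by
    ext ω
    simp only [mem_setOf_eq, mem_iInter, Set.ext_iff, mem_inter_iff, Finset.mem_coe]
    constructor
    · intro h e he; have := h e; tauto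
    · intro h e
      by_cases he : e ∈ E
      · have := h e he; tauto
      · have : e ∉ η := fun h' => he (hηE e h'); tauto
  rw [this]
  refine MeasurableSet.biInter hE.countable fun e he => ?_
  by_cases heη : e ∈ η
  · simp only [heη, iff_true]; exact measurableSet_sigmaOn_mem he
  · simp only [heη, iff_false]; exact (measurableSet_sigmaOn_mem he).compl

/-! ### The probability of one open bond and of all bonds at `0` closed -/

/-- `P_p(e open) = p` for a bond `e`. -/
theorem P_bond_mem (p : I) {e : Sym2 (Vertex d)} (he : e ∈ bonds d) :
    P d p {ω : Config d | e ∈ ω} = ENNReal.ofReal p := by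
  have hdet : DeterminedBy (↑({e} : Finset (Sym2 (Vertex d)))) {ω : Config d | e ∈ ω} := by
    intro ω ω' h
    exact h e (by simp)
  have hE : (↑({e} : Finset (Sym2 (Vertex d))) : Set (Sym2 (Vertex d))) ⊆ bonds d := by
    simpa using he
  have h := Russo.P_toReal_eq_locC p hE hdet
  have hpow : ({e} : Finset (Sym2 (Vertex d))).powerset = {∅, {e}} := by
    ext η; simp [Finset.subset_singleton_iff]
  have hval : Russo.locC ({e} : Finset (Sym2 (Vertex d)))
      (fun η : Finset (Sym2 (Vertex d)) => (↑η : Set (Sym2 (Vertex d))) ∈ {ω : Config d | e ∈ ω}) p = p := by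
    unfold Russo.locC
    rw [hpow, Finset.sum_pair (by simp)]
    simp [Russo.wt]
  rw [hval] at h
  rw [← ENNReal.ofReal_toReal (measure_ne_top (P d p) _), h]

/-- The bonds at `0`. -/
noncomputable def bondsAtZero (d : ℕ) : Finset (Sym2 (Vertex d)) := (nbrs (0 : Vertex d)).image fun y => s(0, y)

/-- Every bond at `0` is a bond. -/
theorem bondsAtZero_subset (d : ℕ) : (↑(bondsAtZero d) : Set (Sym2 (Vertex d))) ⊆ bonds d := by
  intro e he
  obtain ⟨y, hy, rfl⟩ := Finset.mem_image.1 (Finset.mem_coe.1 he)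
  exact (lattice d).mem_edgeSet.2 (mem_nbrs.1 hy)

/-- `P_p(all bonds at 0 closed) = (1 − p)^{2d}`. -/
theorem P_allClosed (p : I) :
    (P d p {ω : Config d | ∀ e ∈ bondsAtZero d, e ∉ ω}).toReal = (1 - p) ^ (bondsAtZero d).card := by
  have hdet : DeterminedBy (↑(bondsAtZero d)) {ω : Config d | ∀ e ∈ bondsAtZero d, e ∉ ω} := by
    intro ω ω' h
    exact forall₂_congr fun e he => not_congr (h e (Finset.mem_coe.2 he))
  rw [Russo.P_toReal_eq_locC p (bondsAtZero_subset d) hdet]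
  unfold Russo.locC
  rw [Finset.sum_eq_single ∅]
  · simp [Russo.wt]
  · intro η hη hne
    rw [if_neg]
    simp only [mem_setOf_eq, Finset.mem_coe, not_forall, not_not]
    obtain ⟨e, he⟩ := Finset.nonempty_iff_ne_empty.2 hne
    exact ⟨e, Finset.mem_powerset.1 hη he, he⟩
  · intro h; exact absurd (Finset.empty_mem_powerset _) h

/-- For `n ≥ 1`, `{0 ↔ ∂Λ_n}` opens some bond at `0`. -/
theorem toBoundary_subset_exists_open {n : ℕ} (hn : 1 ≤ n) :
    toBoundary d n ⊆ {ω : Config d | ∃ e ∈ bondsAtZero d, e ∈ ω} := by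
  rintro ω ⟨z, hz, ⟨w⟩⟩
  cases w with
  | nil =>
    exfalso
    obtain ⟨-, i, hi⟩ := hz
    simp at hi
    omega
  | @cons _ v _ h _ =>
    refine ⟨s(0, v), Finset.mem_image.2 ⟨v, mem_nbrs.2 (openGraph_le ω h), rfl⟩, ?_⟩
    rw [openGraph, SimpleGraph.fromEdgeSet_adj] at h
    exact h.1.1

/-- `P_p(0 ↔ ∂Λ_n) ≤ 1 − (1 − p)^{2d}` for `n ≥ 1`. -/
theorem theta_le_one_sub (p : I) {n : ℕ} (hn : 1 ≤ n) :
    (P d p (toBoundary d n)).toReal ≤ 1 - (1 - p) ^ (bondsAtZero d).card := by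
  have hcompl : {ω : Config d | ∃ e ∈ bondsAtZero d, e ∈ ω} = {ω : Config d | ∀ e ∈ bondsAtZero d, e ∉ ω}ᶜ := by
    ext ω; simp
  have hmeas : MeasurableSet {ω : Config d | ∀ e ∈ bondsAtZero d, e ∉ ω} :=
    Russo.measurableSet_of_determinedBy (bondsAtZero d).finite_toSet fun ω ω' h =>
      forall₂_congr fun e he => not_congr (h e (Finset.mem_coe.2 he))
  have h1 : P d p (toBoundary d n) ≤ P d p {ω : Config d | ∀ e ∈ bondsAtZero d, e ∉ ω}ᶜ := by
    rw [← hcompl]; exact measure_mono (toBoundary_subset_exists_open hn)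
  rw [prob_compl_eq_one_sub hmeas] at h1
  have h2 := ENNReal.toReal_mono (by simp) h1
  rw [ENNReal.toReal_sub_of_le (prob_le_one) (by simp), ENNReal.toReal_one, P_allClosed] at h2
  exact h2

/-! ### The avoiding connection and its translated box bound (Claim 4) -/

/-- A connection through open bonds of `Λ_n` is a connection inside `Λ_n`. -/
theorem conn_boxBonds_iff (n : ℕ) (ω : Config d) (x y : Vertex d) :
    Conn d (ω ∩ boxBonds d n) x y ↔ ConnIn (box d n) ω x y := by
  unfold Conn ConnIn openGraph inGraph
  have : (ω ∩ boxBonds d n) ∩ bonds d = ω ∩ bondsIn (box d n) := by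
    ext e
    simp only [Set.mem_inter_iff, bondsIn, boxBonds, Set.mem_setOf_eq]
    tauto
  rw [this]

/-- `{y ↔_{Λ_n ∖ A} ∂Λ_n}`: `y` is joined to `∂Λ_n` by an open path lying in `Λ_n` and avoiding `A`. -/
def avoid (A : Set (Vertex d)) (n : ℕ) (y : Vertex d) : Set (Config d) :=
  {ω | ∃ z ∈ boundary d n, ConnIn (box d n \ A) ω y z}

/-- Configurations agreeing on `E(T)` have the same connections inside `T`. -/
theorem connIn_congr {T : Set (Vertex d)} {ω ω' : Config d} (h : ∀ e ∈ bondsIn T, (e ∈ ω ↔ e ∈ ω'))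
    (x y : Vertex d) : ConnIn T ω x y ↔ ConnIn T ω' x y :=
  determinedBy_connIn T x y ω ω' h

/-- The avoiding connection is determined by the bonds of `Λ_n ∖ A`. -/
theorem determinedBy_avoid (A : Set (Vertex d)) (n : ℕ) (y : Vertex d) :
    DeterminedBy (bondsIn (box d n \ A)) (avoid A n y) := by
  intro ω ω' h
  show (∃ z ∈ boundary d n, ConnIn (box d n \ A) ω y z) ↔ ∃ z ∈ boundary d n, ConnIn (box d n \ A) ω' y z
  exact exists_congr fun z => and_congr_right fun _ => connIn_congr h y z

/-- `E(Λ_n ∖ A)` is finite. -/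
theorem bondsIn_box_diff_finite (A : Set (Vertex d)) (n : ℕ) : (bondsIn (box d n \ A)).Finite :=
  bondsIn_finite ((box_finite n).subset Set.sdiff_subset)

/-- **Claim 4.** For `y` a neighbour of a point of `Λ_{L−1}`, an avoiding connection from `y` to `∂Λ_{L(k+1)}` gives
`y ↔ y + ∂Λ_{Lk}`, i.e. the translate by `y` of `{0 ↔ ∂Λ_{Lk}}` (F2 + the discrete intermediate value step). -/
theorem avoid_subset_shift (A : Set (Vertex d)) (L k : ℕ) {x y : Vertex d}
    (hx : ∀ i, |x i| + 1 ≤ L) (hadj : (lattice d).Adj x y) :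
    avoid A (L * (k + 1)) y ⊆ shiftConfig y ⁻¹' toBoundary d (L * k) := by
  rintro ω ⟨z, hz, hc⟩
  have hyz : Conn d ω y z := conn_of_connIn hc
  have hyz' : Conn d (shiftConfig y ω) 0 (z - y) := by
    rw [conn_shiftConfig, zero_add, sub_add_cancel]
    exact hyz
  obtain ⟨w⟩ := hyz'
  have hy : ∀ i, |y i| ≤ L := fun i => by
    have h1 := lattice_adj_abs_sub_le hadj i
    have h2 := hx i
    have h3 : |y i| ≤ |x i| + |x i - y i| := by
      calc |y i| = |x i - (x i - y i)| := by rw [sub_sub_cancel]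
        _ ≤ |x i| + |x i - y i| := abs_sub _ _
    linarith
  obtain ⟨hz1, i, hi⟩ := hz
  have hzi : ((L * k : ℕ) : ℤ) ≤ |(z - y) i| := by
    have h1 : |z i| - |y i| ≤ |z i - y i| := abs_sub_abs_le_abs_sub _ _
    have h2 := hy i
    rw [hi] at h1
    rw [Pi.sub_apply]
    push_cast at h1 ⊢
    nlinarith
  have hb : z - y ∉ box d (L * k) ∨ z - y ∈ boundary d (L * k) := by
    by_cases hall : ∀ j, |(z - y) j| ≤ ((L * k : ℕ) : ℤ)
    · exact Or.inr ⟨hall, i, le_antisymm (hall i) hzi⟩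
    · exact Or.inl hall
  obtain ⟨z', hz', hc'⟩ := exists_boundary_of_walk w (zero_mem_box _) hb
  exact ⟨z', hz', conn_mono Set.inter_subset_left hc'⟩

/-- Claim 4 in probability: `P_p(y ↔_{Λ_{L(k+1)} ∖ A} ∂Λ_{L(k+1)}) ≤ P_p(0 ↔ ∂Λ_{Lk})`. -/
theorem P_avoid_le (A : Set (Vertex d)) (L k : ℕ) {x y : Vertex d}
    (hx : ∀ i, |x i| + 1 ≤ L) (hadj : (lattice d).Adj x y) (p : I) :
    P d p (avoid A (L * (k + 1)) y) ≤ P d p (toBoundary d (L * k)) := by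
  calc P d p (avoid A (L * (k + 1)) y) ≤ P d p (shiftConfig y ⁻¹' toBoundary d (L * k)) :=
        measure_mono (avoid_subset_shift A L k hx hadj)
    _ = P d p (toBoundary d (L * k)) := P_shiftConfig_preimage y p (measurableSet_toBoundary _)

/-! ### Claim 2: the last exit from the cluster -/

/-- **Claim 2.** On `{C = A} ∩ {0 ↔ ∂Λ_{L(k+1)}}`, some bond `{x, y}` with `x ∈ A`, `y ∉ S`, `y ∼ x` is open and
`y` is joined to `∂Λ_{L(k+1)}` inside `Λ_{L(k+1)} ∖ A`. -/
theorem cEq_inter_toBoundary_subset {S A : Finset (Vertex d)} (hAS : A ⊆ S) (h0A : (0 : Vertex d) ∈ A)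
    {L : ℕ} (hSL : ∀ x ∈ S, ∀ i, |x i| + 1 ≤ L) (k : ℕ) :
    CEq S A ∩ toBoundary d (L * (k + 1)) ⊆
      ⋃ x ∈ A, ⋃ y ∈ outNbrs (↑S) x, CEq S A ∩ ({ω : Config d | s(x, y) ∈ ω} ∩ avoid (↑A) (L * (k + 1)) y) := by
  rintro ω ⟨hC, hB⟩
  rw [toBoundary_eq_boxConn] at hB
  obtain ⟨z, hz, hconn⟩ := hB
  rw [conn_boxBonds_iff] at hconn
  obtain ⟨w⟩ := hconn
  have hzA : z ∉ (↑A : Set (Vertex d)) := by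
    intro hzA
    obtain ⟨-, i, hi⟩ := hz
    have := hSL z (hAS (Finset.mem_coe.1 hzA)) i
    rw [hi] at this
    push_cast at this
    nlinarith
  have hzT : z ∈ box d (L * (k + 1)) \ (↑A : Set (Vertex d)) := ⟨hz.1, hzA⟩
  rcases exists_exit hzT w with h | ⟨x, y, hxA, hyA, hadj, -, hc⟩
  · exact absurd (Finset.mem_coe.2 h0A) (mem_diff_of_connIn_diff hzT h).2
  · obtain ⟨⟨hω, hb, -, -⟩, -⟩ := inGraph_adj.1 hadj
    have hyS : y ∉ (↑S : Set (Vertex d)) :=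
      notMem_of_exit hC (Finset.mem_coe.1 hxA) (hAS (Finset.mem_coe.1 hxA)) hω hb hyA
    refine Set.mem_iUnion₂.2 ⟨x, Finset.mem_coe.1 hxA, Set.mem_iUnion₂.2 ⟨y, ?_, hC, hω, z, hz, hc⟩⟩
    exact mem_outNbrs.2 ⟨(lattice d).mem_edgeSet.1 hb, hyS⟩

/-! ### Claim 3: independence -/

/-- **Claim 3.** The events `{C = A}`, `{ω_{xy} = 1}` and the avoiding connection from `y` are independent
(they are determined by the pairwise disjoint bond sets `E_A`, `{xy}`, `E(Λ_n ∖ A)`). -/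
theorem P_cEq_inter_eq {S A : Finset (Vertex d)} (hAS : A ⊆ S) (h0A : (0 : Vertex d) ∈ A) (n : ℕ) (p : I)
    {x y : Vertex d} (hxA : x ∈ A) (hy : y ∈ outNbrs (↑S) x) :
    P d p (CEq S A ∩ ({ω : Config d | s(x, y) ∈ ω} ∩ avoid (↑A) n y)) =
      P d p (CEq S A) * (P d p {ω : Config d | s(x, y) ∈ ω} * P d p (avoid (↑A) n y)) := by
  obtain ⟨-, hyS⟩ := mem_outNbrs.1 hy
  have hmem1 : MeasurableSet[sigmaOn (touchBonds (↑S) (↑A))] (CEq S A) :=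
    measurableSet_sigmaOn_of_determinedBy ((bondsIn_finite S.finite_toSet).subset (touchBonds_subset_bondsIn _ _))
      (determinedBy_cEq hAS h0A)
  have hmem2 : MeasurableSet[sigmaOn ({s(x, y)} : Set (Sym2 (Vertex d)))] {ω : Config d | s(x, y) ∈ ω} :=
    measurableSet_sigmaOn_mem (Set.mem_singleton _)
  have hmem3 : MeasurableSet[sigmaOn (bondsIn (box d n \ (↑A : Set (Vertex d))))] (avoid (↑A) n y) :=
    measurableSet_sigmaOn_of_determinedBy (bondsIn_box_diff_finite _ n) (determinedBy_avoid _ n y)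
  have hdisj23 : Disjoint ({s(x, y)} : Set (Sym2 (Vertex d))) (bondsIn (box d n \ (↑A : Set (Vertex d)))) := by
    rw [Set.disjoint_singleton_left]
    intro h
    exact (h.2 x (Sym2.mem_mk_left x y)).2 (Finset.mem_coe.2 hxA)
  have hdisj1 : Disjoint (touchBonds (↑S) (↑A))
      (({s(x, y)} : Set (Sym2 (Vertex d))) ∪ bondsIn (box d n \ (↑A : Set (Vertex d)))) := by
    rw [Set.disjoint_left]
    rintro e ⟨heS, v, hve, hvA⟩ (he | he)
    · rw [Set.mem_singleton_iff] at he
      subst he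
      exact hyS (heS.2 y (Sym2.mem_mk_right x y))
    · exact (he.2 v hve).2 hvA
  rw [P_inter_eq_mul_of_disjoint p hdisj1 hmem1 ?_, P_inter_eq_mul_of_disjoint p hdisj23 hmem2 hmem3]
  exact @MeasurableSet.inter _ (sigmaOn _) _ _
    (sigmaOn_mono Set.subset_union_left _ hmem2) (sigmaOn_mono Set.subset_union_right _ hmem3)

/-! ### The induction step and Theorem S1 -/

/-- `φ_p(S)` as an extended nonnegative real: `p · ∑_{x ∈ S} |{y ∉ S : y ∼ x}| · P_p(0 ↔_S x)`. -/
noncomputable def phiE (S : Finset (Vertex d)) (p : I) : ℝ≥0∞ :=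
  ENNReal.ofReal p * ∑ x ∈ S, ((outNbrs (↑S) x).card : ℝ≥0∞) * P d p {ω : Config d | ConnIn (↑S) ω 0 x}

/-- **The induction step of Theorem S1(i)** (SHARP §3): `P_p(0 ↔ ∂Λ_{L(k+1)}) ≤ φ_p(S) · P_p(0 ↔ ∂Λ_{Lk})` for a finite
`S ∋ 0` with `S ⊆ Λ_{L−1}`. -/
theorem step_bound (S : Finset (Vertex d)) (hS0 : (0 : Vertex d) ∈ S) {L : ℕ}
    (hSL : ∀ x ∈ S, ∀ i, |x i| + 1 ≤ L) (p : I) (k : ℕ) :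
    P d p (toBoundary d (L * (k + 1))) ≤ phiE S p * P d p (toBoundary d (L * k)) := by
  rw [P_eq_sum_cEq hS0 p (measurableSet_toBoundary _)]
  have hA : ∀ A ∈ clusters S, P d p (CEq S A ∩ toBoundary d (L * (k + 1))) ≤
      ∑ x ∈ A, ((outNbrs (↑S) x).card : ℝ≥0∞) *
        (P d p (CEq S A) * (ENNReal.ofReal p * P d p (toBoundary d (L * k)))) := by
    intro A hA
    obtain ⟨hAS, h0A⟩ := mem_clusters.1 hA
    calc P d p (CEq S A ∩ toBoundary d (L * (k + 1)))
        ≤ P d p (⋃ x ∈ A, ⋃ y ∈ outNbrs (↑S) x,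
            CEq S A ∩ ({ω : Config d | s(x, y) ∈ ω} ∩ avoid (↑A) (L * (k + 1)) y)) :=
          measure_mono (cEq_inter_toBoundary_subset hAS h0A hSL k)
      _ ≤ ∑ x ∈ A, P d p (⋃ y ∈ outNbrs (↑S) x,
            CEq S A ∩ ({ω : Config d | s(x, y) ∈ ω} ∩ avoid (↑A) (L * (k + 1)) y)) :=
          measure_biUnion_finset_le _ _
      _ ≤ ∑ x ∈ A, ∑ y ∈ outNbrs (↑S) x,
            P d p (CEq S A ∩ ({ω : Config d | s(x, y) ∈ ω} ∩ avoid (↑A) (L * (k + 1)) y)) :=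
          Finset.sum_le_sum fun x _ => measure_biUnion_finset_le _ _
      _ ≤ ∑ x ∈ A, ∑ y ∈ outNbrs (↑S) x, P d p (CEq S A) * (ENNReal.ofReal p * P d p (toBoundary d (L * k))) := by
          refine Finset.sum_le_sum fun x hx => Finset.sum_le_sum fun y hy => ?_
          rw [P_cEq_inter_eq hAS h0A _ p hx hy, P_bond_mem p ((lattice d).mem_edgeSet.2 (mem_outNbrs.1 hy).1)]
          have hav := P_avoid_le (↑A) L k (hSL x (hAS hx)) (mem_outNbrs.1 hy).1 p
          gcongr
      _ = ∑ x ∈ A, ((outNbrs (↑S) x).card : ℝ≥0∞) *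
            (P d p (CEq S A) * (ENNReal.ofReal p * P d p (toBoundary d (L * k)))) := by
          simp only [Finset.sum_const, nsmul_eq_mul]
  calc ∑ A ∈ clusters S, P d p (CEq S A ∩ toBoundary d (L * (k + 1)))
      ≤ ∑ A ∈ clusters S, ∑ x ∈ A, ((outNbrs (↑S) x).card : ℝ≥0∞) *
          (P d p (CEq S A) * (ENNReal.ofReal p * P d p (toBoundary d (L * k)))) := Finset.sum_le_sum hA
    _ = ∑ x ∈ S, ∑ A ∈ (clusters S).filter (fun A => x ∈ A), ((outNbrs (↑S) x).card : ℝ≥0∞) *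
          (P d p (CEq S A) * (ENNReal.ofReal p * P d p (toBoundary d (L * k)))) := by
        refine Finset.sum_comm' fun A x => ?_
        rw [Finset.mem_filter]
        constructor
        · rintro ⟨hA, hx⟩; exact ⟨⟨hA, hx⟩, (mem_clusters.1 hA).1 hx⟩
        · rintro ⟨⟨hA, hx⟩, -⟩; exact ⟨hA, hx⟩
    _ = ENNReal.ofReal p * (∑ x ∈ S, ((outNbrs (↑S) x).card : ℝ≥0∞) *
          ∑ A ∈ (clusters S).filter (fun A => x ∈ A), P d p (CEq S A)) * P d p (toBoundary d (L * k)) := by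
        rw [Finset.mul_sum, Finset.sum_mul]
        refine Finset.sum_congr rfl fun x _ => ?_
        rw [Finset.mul_sum, Finset.mul_sum, Finset.sum_mul]
        refine Finset.sum_congr rfl fun A _ => ?_
        ring
    _ = phiE S p * P d p (toBoundary d (L * k)) := by
        unfold phiE
        congr 2
        refine Finset.sum_congr rfl fun x hx => ?_
        rw [P_connIn_eq_sum_cEq hS0 p hx]

/-- **Theorem S1(i)**: `P_p(0 ↔ ∂Λ_{Lk}) ≤ φ_p(S)^k`. -/
theorem P_toBoundary_mul_le_pow (S : Finset (Vertex d)) (hS0 : (0 : Vertex d) ∈ S) {L : ℕ}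
    (hSL : ∀ x ∈ S, ∀ i, |x i| + 1 ≤ L) (p : I) (k : ℕ) :
    P d p (toBoundary d (L * k)) ≤ phiE S p ^ k := by
  induction k with
  | zero => simp only [pow_zero]; exact prob_le_one
  | succ k ih =>
    calc P d p (toBoundary d (L * (k + 1))) ≤ phiE S p * P d p (toBoundary d (L * k)) := step_bound S hS0 hSL p k
      _ ≤ phiE S p * phiE S p ^ k := by gcongr
      _ = phiE S p ^ (k + 1) := by ring

/-- `φ_p(S)` as a real number: `p · ∑_{x ∈ S} |{y ∉ S : y ∼ x}| · P_p(0 ↔_S x)` (SHARP Definition 2.1). -/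
noncomputable def phi (S : Finset (Vertex d)) (p : I) : ℝ :=
  p * ∑ x ∈ S, ((outNbrs (↑S) x).card : ℝ) * (P d p {ω : Config d | ConnIn (↑S) ω 0 x}).toReal

/-- `φ_p(S) ≥ 0`. -/
theorem phi_nonneg (S : Finset (Vertex d)) (p : I) : 0 ≤ phi S p :=
  mul_nonneg p.2.1 (Finset.sum_nonneg fun _ _ => mul_nonneg (Nat.cast_nonneg _) ENNReal.toReal_nonneg)

/-- `phiE = ENNReal.ofReal phi`. -/
theorem phiE_eq_ofReal (S : Finset (Vertex d)) (p : I) : phiE S p = ENNReal.ofReal (phi S p) := by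
  unfold phiE phi
  rw [ENNReal.ofReal_mul p.2.1, ENNReal.ofReal_sum_of_nonneg (fun _ _ =>
    mul_nonneg (Nat.cast_nonneg _) ENNReal.toReal_nonneg)]
  congr 1
  refine Finset.sum_congr rfl fun x _ => ?_
  rw [ENNReal.ofReal_mul (Nat.cast_nonneg _), ENNReal.ofReal_natCast, ENNReal.ofReal_toReal (measure_ne_top _ _)]

/-- **Theorem S1(ii)**: `P_p(0 ↔ ∂Λ_n) ≤ φ_p(S)^{⌊n/L⌋}`. -/
theorem theta_le_phi_pow_div (S : Finset (Vertex d)) (hS0 : (0 : Vertex d) ∈ S) {L : ℕ}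
    (hSL : ∀ x ∈ S, ∀ i, |x i| + 1 ≤ L) (p : I) (n : ℕ) :
    (P d p (toBoundary d n)).toReal ≤ phi S p ^ (n / L) := by
  refine ENNReal.toReal_le_of_le_ofReal (pow_nonneg (phi_nonneg S p) _) ?_
  rw [ENNReal.ofReal_pow (phi_nonneg S p), ← phiE_eq_ofReal]
  calc P d p (toBoundary d n) ≤ P d p (toBoundary d (L * (n / L))) :=
        measure_mono (toBoundary_antitone (Nat.mul_div_le n L))
    _ ≤ phiE S p ^ (n / L) := P_toBoundary_mul_le_pow S hS0 hSL p (n / L)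

/-- **Corollary S1′** (SHARP §3): if `φ_p(S) < 1` for some finite `S ∋ 0` contained in `Λ_{L−1}` and `p < 1`, then
`P_p(0 ↔ ∂Λ_n) ≤ e^{−cn}` for all `n ≥ 1`, for some `c > 0`. -/
theorem exp_decay_of_phi_lt_one (p : I) (hp1 : (p : ℝ) < 1) (S : Finset (Vertex d)) (hS0 : (0 : Vertex d) ∈ S)
    {L : ℕ} (hL : 1 ≤ L) (hSL : ∀ x ∈ S, ∀ i, |x i| + 1 ≤ L) (hphi : phi S p < 1) :
    ∃ c : ℝ, 0 < c ∧ ∀ n : ℕ, 1 ≤ n → (P d p (toBoundary d n)).toReal ≤ Real.exp (-(c * n)) := by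
  have hb1 : 1 - (1 - (p : ℝ)) ^ (bondsAtZero d).card < 1 := by
    have : 0 < (1 - (p : ℝ)) ^ (bondsAtZero d).card := pow_pos (by linarith) _
    linarith
  have hb0 : 0 ≤ 1 - (1 - (p : ℝ)) ^ (bondsAtZero d).card := by
    have : (1 - (p : ℝ)) ^ (bondsAtZero d).card ≤ 1 := pow_le_one₀ (by linarith [p.2.1]) (by linarith [p.2.1])
    linarith
  exact exp_decay_of_block_bound (fun n => (P d p (toBoundary d n)).toReal) (phi S p)
    (1 - (1 - (p : ℝ)) ^ (bondsAtZero d).card) L hL (phi_nonneg S p) hphi hb0 hb1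
    (fun n => theta_le_phi_pow_div S hS0 hSL p n) (fun n hn => theta_le_one_sub p hn)

end Summit.Ventures.PercRepro0.Sharp
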